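import Summits.CriticalPhenomena.PercolationContinuityZ3.Theorems.PercNearOneGluingNoHeavyLowerTailSunflowerHallGladkov
import HarnessLib
import HarnessLib.Audit

/-!
# `NoHeavyLowerTail` (crux stmt-CriticalPhenomena-4575), abstract sunflower cubic: MATCHING (marriage) versions of the antipodal Harris inequality
# and of Gladkov's two-petal inequality — the two unconditional building blocks of the HALL–GLADKOV programme

Support file (seat `prim-l12-p2` gen 15; `--supports stmt-CriticalPhenomena-4575`; companion of `…SunflowerHallGladkov`).  Nothing is asserted about
the crux; no `sorry`, no named facts, standard axioms.  Memo: run/shared/lean/prim/prim-l12/prim-l12-p2/FINDING-g15-HALL-GLADKOV.md §1–§2.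

CONTEXT.  `…SunflowerHallGladkov` reduced "★ for every sunflower with an intersecting petal" to the MARRIAGE statement `HallGladkov` for two up-sets
(`POS ↪ NEG` along containment).  This file proves the two marriage statements that ARE theorems and that bracket it:

* `antipodalHarris_sum_nonneg` / `antipodalHarris`: for up-sets `X, Y` and every cube `W` (with offsets `G₂ ⊆ G₁`, polarised form),
  `0 ≤ Σ_{S ⊆ W} (𝟙_X(G₁ ∪ S) − 𝟙_X(G₂ ∪ (W∖S)))·(𝟙_Y(G₁ ∪ S) − 𝟙_Y(G₂ ∪ (W∖S)))` — the antipodal (two-copy fibre) Harris inequality, by the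
  five-line induction of `Sunflower.antipodal_sum_nonneg` (the kernel `(a−a')(b−b')` is submodular on comparable rectangles).
* `card_inV_filter_le` : for an up-set `V`, a cube `W` and a down-set `D`: `#{T ∈ D : T ⊆ W, T ∈ V, W∖T ∉ V} ≤ #{O ∈ D : O ⊆ W, O ∉ V, W∖O ∈ V}`
  (antipodal Harris against the up-set "`· ∩ W ∉ D`" plus the complement symmetry of the cube), and hence, by Hall's theorem,
* **`antipodalMatching`** (ANTIPODAL HARRIS, MARRIAGE FORM): the "in-sides" `IN = {T ⊆ W : T ∈ V, W∖T ∉ V}` of the mixed antipodal pairs of an up-set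
  admit an injection `φ` into the "out-sides" `OUT = {O ⊆ W : O ∉ V, W∖O ∈ V}` with `φ T ⊆ T` (`|IN| = |OUT|`, so a perfect matching).  This is
  `HallGladkov` for the pair `(V, ∅)`; the memo (§2) also gives an explicit recursive construction of `φ`.
* **`gladkovMatching`** (GLADKOV'S TWO-PETAL INEQUALITY, MARRIAGE FORM): for up-sets `V₁, V₂` (kernel `K = V₁ ∩ V₂`, petals `C_i = V_i ∖ V_j`, bottom
  `B = (V₁ ∪ V₂)ᶜ`) and every cube `W`, the cross antipodal pairs `{T ⊆ W : T ∈ C₁, W∖T ∈ C₂}` inject into the kernel–bottom pairs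
  `{R ⊆ W : R ∈ K, W∖R ∈ B}` by a map with `T ⊆ R` (apply `antipodalMatching` for `V₂` to the `C₂`-side and take complements).  Counting only, this is
  the cube form `#{C₁|C₂} ≤ #{K|B}` of Gladkov's `ab ≥ c₁c₂ + …` (`Sunflower.card_distinctPetals_le`); the containment is new information, and it is
  exactly the part of `HallGladkov` that concerns the cross pairs (memo §1d: `antipodalMatching` for `V₁` also places the whole `C₁`-part of `POS`
  inside `NEG`; the open point of `HallGladkov` is only the contention for kernel-complement slots between the `V₁`- and `V₂`-matchings).
-/

namespace Summit.CriticalPhenomena.PercolationContinuityZ3.Theorems.SunflowerPartition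

open Finset

namespace HallGladkov

variable {α : Type*} [DecidableEq α]

/-! ## Antipodal Harris for two up-sets (cube form with offsets) -/

/-- `𝟙_X` as an integer. [this work] -/
def ind (X : Finset (Finset α)) (T : Finset α) : ℤ := if T ∈ X then 1 else 0

omit [DecidableEq α] in
/-- `𝟙_X` is monotone for an up-set `X`. [this work] -/
theorem ind_mono [DecidableEq α] {X : Finset (Finset α)} (hX : IsUpperSet (X : Set (Finset α))) {S T : Finset α} (h : S ⊆ T) :
    ind X S ≤ ind X T := by
  unfold ind
  by_cases hS : S ∈ X
  · have hT : T ∈ X := hX h hS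
    rw [if_pos hS, if_pos hT]
  · rw [if_neg hS]; split_ifs <;> norm_num

/-- The arithmetic of the induction step: the kernel `(a − c)(b − d)` is submodular on comparable rectangles. [this work] -/
theorem step_arith {a₀ a₁ b₀ b₁ c₀ c₁ d₀ d₁ : ℤ} (ha : a₀ ≤ a₁) (hb : b₀ ≤ b₁) (hc : c₀ ≤ c₁) (hd : d₀ ≤ d₁) :
    (a₀ - c₀) * (b₀ - d₀) + (a₁ - c₁) * (b₁ - d₁) ≤ (a₀ - c₁) * (b₀ - d₁) + (a₁ - c₀) * (b₁ - d₀) := by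
  nlinarith [mul_nonneg (sub_nonneg.2 ha) (sub_nonneg.2 hd), mul_nonneg (sub_nonneg.2 hb) (sub_nonneg.2 hc)]

/-- **Antipodal Harris with offsets** (this work): for up-sets `X, Y` and `G₂ ⊆ G₁`,
`0 ≤ Σ_{S ⊆ W} (𝟙_X(G₁ ∪ S) − 𝟙_X(G₂ ∪ (W ∖ S)))·(𝟙_Y(G₁ ∪ S) − 𝟙_Y(G₂ ∪ (W ∖ S)))`. [this work] -/
theorem antipodalHarris_sum_nonneg {X Y : Finset (Finset α)} (hX : IsUpperSet (X : Set (Finset α))) (hY : IsUpperSet (Y : Set (Finset α)))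
    (W : Finset α) : ∀ G₁ G₂ : Finset α, G₂ ⊆ G₁ →
      0 ≤ ∑ S ∈ W.powerset, (ind X (G₁ ∪ S) - ind X (G₂ ∪ (W \ S))) * (ind Y (G₁ ∪ S) - ind Y (G₂ ∪ (W \ S))) := by
  induction W using Finset.induction_on with
  | empty =>
    intro G₁ G₂ h
    simp only [powerset_empty, sum_singleton, union_empty, sdiff_self, bot_eq_empty]
    exact mul_nonneg (sub_nonneg.2 (ind_mono hX h)) (sub_nonneg.2 (ind_mono hY h))
  | insert e W' he ih =>
    intro G₁ G₂ h
    rw [sum_powerset_insert he]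
    have key : ∀ S ∈ W'.powerset,
        (ind X (G₁ ∪ S) - ind X (G₂ ∪ (W' \ S))) * (ind Y (G₁ ∪ S) - ind Y (G₂ ∪ (W' \ S)))
          + (ind X (insert e G₁ ∪ S) - ind X (insert e G₂ ∪ (W' \ S))) * (ind Y (insert e G₁ ∪ S) - ind Y (insert e G₂ ∪ (W' \ S)))
          ≤ (ind X (G₁ ∪ S) - ind X (G₂ ∪ (insert e W' \ S))) * (ind Y (G₁ ∪ S) - ind Y (G₂ ∪ (insert e W' \ S)))
            + (ind X (G₁ ∪ insert e S) - ind X (G₂ ∪ (insert e W' \ insert e S)))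
              * (ind Y (G₁ ∪ insert e S) - ind Y (G₂ ∪ (insert e W' \ insert e S))) := by
      intro S hS
      have hSW : S ⊆ W' := mem_powerset.1 hS
      have heS : e ∉ S := fun hx => he (hSW hx)
      rw [Sunflower.union_insert_sdiff heS, Sunflower.insert_sdiff_insert_of_not_mem he, Sunflower.union_insert_eq]
      have h1 : G₁ ∪ S ⊆ insert e G₁ ∪ S := union_subset_union (subset_insert e G₁) (subset_refl S)
      have h2 : G₂ ∪ (W' \ S) ⊆ insert e G₂ ∪ (W' \ S) := union_subset_union (subset_insert e G₂) (subset_refl (W' \ S))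
      exact step_arith (ind_mono hX h1) (ind_mono hY h1) (ind_mono hX h2) (ind_mono hY h2)
    have hsum := sum_le_sum key
    rw [sum_add_distrib, sum_add_distrib] at hsum
    have ih1 := ih G₁ G₂ h
    have ih2 := ih (insert e G₁) (insert e G₂) (insert_subset_insert e h)
    linarith

/-- **Antipodal Harris** (this work): `0 ≤ Σ_{S ⊆ W} (𝟙_X(S) − 𝟙_X(W∖S))·(𝟙_Y(S) − 𝟙_Y(W∖S))` for up-sets `X, Y` — the two-copy fibre form of
Harris' inequality (equivalently Harris + Kleitman: `E[XY] ≥ E[X]E[Y] ≥ E[X(S)Y(W∖S)]`). [this work] -/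
theorem antipodalHarris {X Y : Finset (Finset α)} (hX : IsUpperSet (X : Set (Finset α))) (hY : IsUpperSet (Y : Set (Finset α)))
    (W : Finset α) : 0 ≤ ∑ S ∈ W.powerset, (ind X S - ind X (W \ S)) * (ind Y S - ind Y (W \ S)) := by
  have h := antipodalHarris_sum_nonneg hX hY W ∅ ∅ subset_rfl
  simpa only [empty_union] using h

/-! ## Antipodal Harris, marriage form -/

/-- `IN`: in-sides of the mixed antipodal pairs of `V` inside the cube `W`. [this work] -/
def inV (V : Finset (Finset α)) (W : Finset α) : Finset (Finset α) := W.powerset.filter fun T => T ∈ V ∧ W \ T ∉ V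

/-- `OUT`: out-sides of the mixed antipodal pairs of `V` inside the cube `W`. [this work] -/
def outV (V : Finset (Finset α)) (W : Finset α) : Finset (Finset α) := W.powerset.filter fun O => O ∉ V ∧ W \ O ∈ V

omit [DecidableEq α] in
/-- Swapping `S ↔ W ∖ S` in a sum over a cube. [folklore] -/
theorem sum_powerset_swap [DecidableEq α] (W : Finset α) (f : Finset α → Finset α → ℤ) :
    ∑ S ∈ W.powerset, f S (W \ S) = ∑ S ∈ W.powerset, f (W \ S) S := by
  refine sum_bij' (fun S _ => W \ S) (fun S _ => W \ S) ?_ ?_ ?_ ?_ ?_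
  · intro S _; exact mem_powerset.2 sdiff_subset
  · intro S _; exact mem_powerset.2 sdiff_subset
  · intro S hS; exact Finset.sdiff_sdiff_eq_self (mem_powerset.1 hS)
  · intro S hS; exact Finset.sdiff_sdiff_eq_self (mem_powerset.1 hS)
  · intro S hS; rw [Finset.sdiff_sdiff_eq_self (mem_powerset.1 hS)]

/-- **Hall's condition for the antipodal marriage** (this work): for an up-set `V`, a cube `W` and a down-set `D`,
`#(IN ∩ D) ≤ #(OUT ∩ D)`; in fact `2·(#(OUT ∩ D) − #(IN ∩ D))` equals the antipodal Harris sum of `V` against the up-set `{F : F ∩ W ∉ D}`. [this work] -/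
theorem card_inV_filter_le [Fintype α] {V D : Finset (Finset α)} (hV : IsUpperSet (V : Set (Finset α)))
    (hD : IsLowerSet (D : Set (Finset α))) (W : Finset α) :
    ((inV V W).filter (· ∈ D)).card ≤ ((outV V W).filter (· ∈ D)).card := by
  classical
  set U : Finset (Finset α) := univ.filter fun F => F ∩ W ∉ D with hUdef
  have hU : IsUpperSet (U : Set (Finset α)) := by
    intro A B hAB hA
    rw [Finset.mem_coe, hUdef, mem_filter] at hA ⊢
    exact ⟨mem_univ _, fun hB => hA.2 (hD (inter_subset_inter hAB subset_rfl) hB)⟩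
  have hUmem : ∀ S, S ⊆ W → (S ∈ U ↔ S ∉ D) := by
    intro S hS
    rw [hUdef, mem_filter, inter_eq_left.2 hS]
    simp
  have h := antipodalHarris hV hU W
  set ID := (inV V W).filter (· ∈ D) with hID
  set OD := (outV V W).filter (· ∈ D) with hOD
  have hsubI : ID ⊆ W.powerset := fun T hT => by
    rw [hID, mem_filter] at hT; unfold inV at hT; exact (mem_filter.1 hT.1).1
  have hsubO : OD ⊆ W.powerset := fun T hT => by
    rw [hOD, mem_filter] at hT; unfold outV at hT; exact (mem_filter.1 hT.1).1
  have hI : ((ID.card : ℤ)) = ∑ S ∈ W.powerset, (if S ∈ ID then (1 : ℤ) else 0) := by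
    rw [Finset.sum_boole, Finset.filter_mem_eq_inter, inter_eq_right.2 hsubI]
  have hO : ((OD.card : ℤ)) = ∑ S ∈ W.powerset, (if S ∈ OD then (1 : ℤ) else 0) := by
    rw [Finset.sum_boole, Finset.filter_mem_eq_inter, inter_eq_right.2 hsubO]
  -- membership characterisations inside the cube
  have memID : ∀ S, S ⊆ W → (S ∈ ID ↔ S ∈ V ∧ W \ S ∉ V ∧ S ∈ D) := by
    intro S hS
    rw [hID, mem_filter]; unfold inV; rw [mem_filter, mem_powerset]; tauto
  have memOD : ∀ S, S ⊆ W → (S ∈ OD ↔ S ∉ V ∧ W \ S ∈ V ∧ S ∈ D) := by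
    intro S hS
    rw [hOD, mem_filter]; unfold outV; rw [mem_filter, mem_powerset]; tauto
  -- the pointwise antisymmetry: 2·([OD] − [ID]) − HarrisSummand is odd under `S ↔ W ∖ S`
  let g : Finset α → ℤ := fun S => (if S ∈ OD then (1 : ℤ) else 0) - (if S ∈ ID then (1 : ℤ) else 0)
  let hh : Finset α → ℤ := fun S => (ind V S - ind V (W \ S)) * (ind U S - ind U (W \ S))
  have hanti : ∀ S ∈ W.powerset, 2 * g S - hh S = -(2 * g (W \ S) - hh (W \ S)) := by
    intro S hS
    have hSW : S ⊆ W := mem_powerset.1 hS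
    have hS'W : W \ S ⊆ W := sdiff_subset
    have hWS : W \ (W \ S) = S := Finset.sdiff_sdiff_eq_self hSW
    simp only [g, hh, hWS]
    have e1 := memID S hSW
    have e2 := memOD S hSW
    have e3 := memID (W \ S) hS'W
    have e4 := memOD (W \ S) hS'W
    rw [hWS] at e3 e4
    have u1 := hUmem S hSW
    have u2 := hUmem (W \ S) hS'W
    unfold ind
    by_cases hv : S ∈ V <;> by_cases hv' : W \ S ∈ V <;> by_cases hd : S ∈ D <;> by_cases hd' : W \ S ∈ D <;>
      simp [hv, hv', hd, hd', e1, e2, e3, e4, u1, u2]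
  have hswap := sum_powerset_swap W (fun A _ => 2 * g A - hh A)
  have hzero : ∑ S ∈ W.powerset, (2 * g S - hh S) = 0 := by
    have : ∑ S ∈ W.powerset, (2 * g S - hh S) = ∑ S ∈ W.powerset, -(2 * g (W \ S) - hh (W \ S)) :=
      sum_congr rfl hanti
    rw [sum_neg_distrib, ← hswap] at this
    linarith
  rw [sum_sub_distrib, ← mul_sum] at hzero
  have hg : ∑ S ∈ W.powerset, g S = (OD.card : ℤ) - (ID.card : ℤ) := by
    simp only [g]
    rw [sum_sub_distrib, ← hI, ← hO]
  have h2 : 0 ≤ ∑ S ∈ W.powerset, hh S := h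
  have : (ID.card : ℤ) ≤ (OD.card : ℤ) := by linarith
  exact_mod_cast this

/-- **ANTIPODAL HARRIS, MARRIAGE FORM** (this work): for an up-set `V` and a cube `W`, the in-sides `IN = {T ⊆ W : T ∈ V, W ∖ T ∉ V}` of the mixed
antipodal pairs admit an injection `φ` into the out-sides `OUT = {O ⊆ W : O ∉ V, W ∖ O ∈ V}` with `φ T ⊆ T` (and `|IN| = |OUT|`, so `φ` is a
perfect matching).  Hall's theorem on `card_inV_filter_le`; the memo gives an explicit recursive construction. [this work] -/
theorem antipodalMatching [Fintype α] {V : Finset (Finset α)} (hV : IsUpperSet (V : Set (Finset α))) (W : Finset α) :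
    ∃ φ : Finset α → Finset α, Set.InjOn φ (inV V W : Set (Finset α)) ∧ ∀ T ∈ inV V W, φ T ∈ outV V W ∧ φ T ⊆ T := by
  classical
  set P := inV V W with hP
  set N := outV V W with hN
  have hall : ∀ s : Finset P, s.card ≤ (s.biUnion fun T => N.filter (· ⊆ (T.1 : Finset α))).card := by
    intro s
    let D : Finset (Finset α) := (s.image Subtype.val).biUnion fun T => T.powerset
    have hD : IsLowerSet (D : Set (Finset α)) := isLowerSet_biUnion_powerset _
    have key := card_inV_filter_le (D := D) hV hD W
    have h1 : s.card ≤ (P.filter (· ∈ D)).card := by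
      rw [← Finset.card_image_of_injective s Subtype.val_injective]
      refine card_le_card fun T hT => ?_
      obtain ⟨x, hx, rfl⟩ := mem_image.1 hT
      exact mem_filter.2 ⟨x.2, mem_biUnion.2 ⟨x.1, mem_image.2 ⟨x, hx, rfl⟩, mem_powerset.2 subset_rfl⟩⟩
    have h2 : N.filter (· ∈ D) = s.biUnion fun T => N.filter (· ⊆ (T.1 : Finset α)) := by
      ext O
      constructor
      · intro hO
        obtain ⟨hON, hOD⟩ := mem_filter.1 hO
        obtain ⟨T, hT, hOT⟩ := mem_biUnion.1 hOD
        obtain ⟨x, hx, rfl⟩ := mem_image.1 hT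
        exact mem_biUnion.2 ⟨x, hx, mem_filter.2 ⟨hON, mem_powerset.1 hOT⟩⟩
      · intro hO
        obtain ⟨x, hx, hOx⟩ := mem_biUnion.1 hO
        exact mem_filter.2 ⟨(mem_filter.1 hOx).1, mem_biUnion.2 ⟨x.1, mem_image.2 ⟨x, hx, rfl⟩, mem_powerset.2 (mem_filter.1 hOx).2⟩⟩
    rw [← h2]
    exact le_trans h1 key
  obtain ⟨f, hf, hf2⟩ := (Finset.all_card_le_biUnion_card_iff_exists_injective _).1 hall
  refine ⟨fun T => if hT : T ∈ P then f ⟨T, hT⟩ else ∅, ?_, ?_⟩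
  · intro T hT T' hT' hTT'
    have hTP : T ∈ P := hT
    have hTP' : T' ∈ P := hT'
    have e : f ⟨T, hTP⟩ = f ⟨T', hTP'⟩ := by simpa only [dif_pos hTP, dif_pos hTP'] using hTT'
    exact congrArg Subtype.val (hf e)
  · intro T hT
    have hTP : T ∈ P := hT
    simp only [dif_pos hTP]
    exact mem_filter.1 (hf2 ⟨T, hTP⟩)

/-! ## Gladkov's two-petal inequality, marriage form -/

/-- Cross antipodal pairs of `(V₁,V₂)` inside `W`, listed by their `C₁`-side: `{T ⊆ W : T ∈ V₁ ∖ V₂, W ∖ T ∈ V₂ ∖ V₁}`. [this work] -/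
def cross (V₁ V₂ : Finset (Finset α)) (W : Finset α) : Finset (Finset α) :=
  W.powerset.filter fun T => T ∈ V₁ ∧ T ∉ V₂ ∧ W \ T ∈ V₂ ∧ W \ T ∉ V₁

/-- Kernel–bottom antipodal pairs inside `W`, listed by their kernel side: `{R ⊆ W : R ∈ V₁ ∩ V₂, W ∖ R ∉ V₁ ∪ V₂}`. [this work] -/
def kerBot (V₁ V₂ : Finset (Finset α)) (W : Finset α) : Finset (Finset α) :=
  W.powerset.filter fun R => R ∈ V₁ ∧ R ∈ V₂ ∧ W \ R ∉ V₁ ∧ W \ R ∉ V₂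

/-- **GLADKOV'S TWO-PETAL INEQUALITY, MARRIAGE FORM** (this work): for up-sets `V₁, V₂` and a cube `W` there is an injection `ρ` from the cross
antipodal pairs to the kernel–bottom antipodal pairs with `T ⊆ ρ T` (the kernel side contains the `C₁`-side).  In particular
`#{C₁|C₂} ≤ #{K|B}` (Gladkov's `μ(A)μ(B) ≥ Σ c_ic_j` in cube form); the containment is the new information. [this work] -/
theorem gladkovMatching [Fintype α] {V₁ V₂ : Finset (Finset α)} (h₁ : IsUpperSet (V₁ : Set (Finset α)))
    (h₂ : IsUpperSet (V₂ : Set (Finset α))) (W : Finset α) :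
    ∃ ρ : Finset α → Finset α, Set.InjOn ρ (cross V₁ V₂ W : Set (Finset α)) ∧ ∀ T ∈ cross V₁ V₂ W, ρ T ∈ kerBot V₁ V₂ W ∧ T ⊆ ρ T := by
  obtain ⟨φ, hinj, hφ⟩ := antipodalMatching h₂ W
  -- `ρ T = W ∖ φ (W ∖ T)`: the `C₂`-side `W ∖ T` is an in-side of `V₂`; push it down and take the complement
  have hin : ∀ T ∈ cross V₁ V₂ W, W \ T ∈ inV V₂ W := by
    intro T hT
    unfold cross at hT
    obtain ⟨hTW, _, hT2, hS2, _⟩ := mem_filter.1 hT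
    unfold inV
    rw [mem_filter, mem_powerset, Finset.sdiff_sdiff_eq_self (mem_powerset.1 hTW)]
    exact ⟨sdiff_subset, hS2, hT2⟩
  refine ⟨fun T => W \ φ (W \ T), ?_, ?_⟩
  · intro T hT T' hT' hTT'
    have hTW : T ⊆ W := mem_powerset.1 (mem_filter.1 (Finset.mem_coe.1 hT)).1
    have hTW' : T' ⊆ W := mem_powerset.1 (mem_filter.1 (Finset.mem_coe.1 hT')).1
    have h1 := hin T hT
    have h1' := hin T' hT'
    have hφ1 : φ (W \ T) ⊆ W := subset_trans (hφ _ h1).2 sdiff_subset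
    have hφ1' : φ (W \ T') ⊆ W := subset_trans (hφ _ h1').2 sdiff_subset
    have e : φ (W \ T) = φ (W \ T') := by
      have := congrArg (fun A => W \ A) hTT'
      simpa only [Finset.sdiff_sdiff_eq_self hφ1, Finset.sdiff_sdiff_eq_self hφ1'] using this
    have e2 : W \ T = W \ T' := hinj h1 h1' e
    have := congrArg (fun A => W \ A) e2
    simpa only [Finset.sdiff_sdiff_eq_self hTW, Finset.sdiff_sdiff_eq_self hTW'] using this
  · intro T hT
    have hTW : T ⊆ W := mem_powerset.1 (mem_filter.1 hT).1
    obtain ⟨hO, hOS⟩ := hφ _ (hin T hT)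
    unfold outV at hO
    obtain ⟨hOW, hOV2, hWO⟩ := mem_filter.1 hO
    have hOW' : φ (W \ T) ⊆ W := mem_powerset.1 hOW
    unfold cross at hT
    obtain ⟨_, hT1, hT2, hS2, hS1⟩ := mem_filter.1 hT
    unfold kerBot
    rw [mem_filter, mem_powerset, Finset.sdiff_sdiff_eq_self hOW']
    have hTR : T ⊆ W \ φ (W \ T) := by
      intro x hx
      rw [mem_sdiff]
      refine ⟨hTW hx, fun hxO => ?_⟩
      have := hOS hxO
      rw [mem_sdiff] at this
      exact this.2 hx
    exact ⟨⟨sdiff_subset, h₁ hTR hT1, hWO, fun hmem => hS1 (h₁ hOS hmem), hOV2⟩, hTR⟩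

/-! ## `HallGladkov` for nested pairs -/

/-- The matching statement `HallGladkov` holds for NESTED pairs `V₂ ⊆ V₁`: then `POS ⊆ IN(V₁)` and `NEG = OUT(V₁)`, so `antipodalMatching`
for `V₁` does it.  (Likewise for `V₁ ⊆ V₂` by the symmetric argument; the general case is the open conjecture.) [this work] -/
theorem posNegMatching_of_subset [Fintype α] {V₁ V₂ : Finset (Finset α)} (h₁ : IsUpperSet (V₁ : Set (Finset α))) (h : V₂ ⊆ V₁)
    (W : Finset α) :
    ∃ φ : Finset α → Finset α, Set.InjOn φ (pos V₁ V₂ W : Set (Finset α)) ∧ ∀ T ∈ pos V₁ V₂ W, φ T ∈ neg V₁ V₂ W ∧ φ T ⊆ T := by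
  obtain ⟨φ, hinj, hφ⟩ := antipodalMatching h₁ W
  have hsub : pos V₁ V₂ W ⊆ inV V₁ W := by
    intro T hT
    unfold pos at hT; unfold inV
    rw [mem_filter] at hT ⊢
    rcases hT.2 with ⟨hT1, _, hS1⟩ | ⟨hT2, hT1, _, _⟩
    · exact ⟨hT.1, hT1, hS1⟩
    · exact absurd (h hT2) hT1
  refine ⟨φ, hinj.mono (fun T hT => Finset.mem_coe.2 (hsub (Finset.mem_coe.1 hT))), fun T hT => ?_⟩
  obtain ⟨hO, hOT⟩ := hφ T (hsub hT)
  unfold outV at hO; unfold neg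
  rw [mem_filter] at hO ⊢
  exact ⟨⟨hO.1, hO.2.1, fun h2 => hO.2.1 (h h2), Or.inl hO.2.2⟩, hOT⟩

end HallGladkov

end Summit.CriticalPhenomena.PercolationContinuityZ3.Theorems.SunflowerPartition
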